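import Summits.CriticalPhenomena.PercolationContinuityZ3.Theorems.Transplant.PlanarSkeletonFrmQuasiDefs
import Summits.CriticalPhenomena.PercolationContinuityZ3.Theorems.Transplant.SkelPhiCorridorKGRoomsQYD
import Summits.CriticalPhenomena.PercolationContinuityZ3.Theorems.Transplant.SkelFrmQuasiBChoiceDefs3
import Summits.CriticalPhenomena.PercolationContinuityZ3.Theorems.Transplant.SkelFrmBChoiceDefs3
import Summits.CriticalPhenomena.PercolationContinuityZ3.Theorems.Transplant.SkelFrmFromBChoiceGeom
import Summits.CriticalPhenomena.PercolationContinuityZ3.Theorems.Transplant.SkelFrmBChoiceGeom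
import Summits.CriticalPhenomena.PercolationContinuityZ3.Theorems.Transplant.SkelFrmQuasiBChoiceLinks
import Summits.CriticalPhenomena.PercolationContinuityZ3.Theorems.Transplant.SkelFrmBChoiceLinks
import Summits.CriticalPhenomena.PercolationContinuityZ3.Theorems.Transplant.SkelFrmQuasiBChoiceKit
import Summits.CriticalPhenomena.PercolationContinuityZ3.Theorems.Transplant.SkelFrmBChoiceKit
import Summits.CriticalPhenomena.PercolationContinuityZ3.Theorems.Transplant.SkelFrmFromBChoiceZone
import Summits.CriticalPhenomena.PercolationContinuityZ3.Theorems.Transplant.SkelFrmBChoiceZone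
import Summits.CriticalPhenomena.PercolationContinuityZ3.Theorems.Transplant.SkelFrmFromBChoiceRooms
import Summits.CriticalPhenomena.PercolationContinuityZ3.Theorems.Transplant.SkelFrmBChoiceRooms
import Summits.CriticalPhenomena.PercolationContinuityZ3.Theorems.Transplant.SkelFrmQuasiBChoiceNums
import Summits.CriticalPhenomena.PercolationContinuityZ3.Theorems.Transplant.SkelFrmBChoiceNums
import Summits.CriticalPhenomena.PercolationContinuityZ3.Theorems.Transplant.SkelFrmQuasiBParamsSchedA
import Summits.CriticalPhenomena.PercolationContinuityZ3.Theorems.Transplant.SkelFrmBParamsSchedA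
import Summits.CriticalPhenomena.PercolationContinuityZ3.Theorems.Transplant.SkelFrmQuasiBParamsCorrKG
import Summits.CriticalPhenomena.PercolationContinuityZ3.Theorems.Transplant.SkelFrmBParamsCorrKG
import Summits.CriticalPhenomena.PercolationContinuityZ3.Theorems.Transplant.SkelFrmQuasi1SlotTypes
import HarnessLib
import Summits.CriticalPhenomena.PercolationContinuityZ3.Theorems.Transplant.SkelFrm1ReachRowsQD
/-!
# GEN-Q PORT (WAVE-Q table v0.8 section 2, row G065, U-level L11; captain R-6/R-7 2026-08-27: carrier token swap `PlanarSkeletonFrmFrom ↦ PlanarSkeletonFrmQuasi`)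
# of the tree module «Transplant/SkelFrmFrom1ReachRowsQD» (sha256 a61f13177795092a…) onto the quasi-step carrier `PlanarSkeletonFrmQuasi` (p507026): «SkelFrmQuasi1ReachRowsQD»

ORIGINAL TITLE: N2 (frames-only node `SamePDropOfSkeletonFrm₁`, OPEN), (C) column: THE CORRIDOR RESIDUE OF THE CHOICE FUNCTION OF RECORD AT ONE PROBE, FIRST AXIS,

builds on p205010 (kernel theorem, internal audit signed; external expert review pending) — nothing in this file uses p205010; NOTHING is claimed about any open node
((N3-b), the end state).  Lane `prim-bschramm`, seat `prim-bschramm-stmt` (gen 33; GEN-Q column pen; tool = captain gen-1 g4's port_genq.py R-14 --cone + p3-g30's T1 patch).  Helper file (`--supports stmt-CriticalPhenomena-4575 --as helper`).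
PORT RULES (U-wave r1–r4 re-used, GEN-Q hunk classes of p3-g29 #6136): declaration order, names and proof texts are those of «SkelFrmFrom1ReachRowsQD», byte-identical except
(i) the carrier token `PlanarSkeletonFrmFrom ↦ PlanarSkeletonFrmQuasi` in binders, `namespace`/`end` lines and qualified names (module names `SkelFrmFrom… ↦ SkelFrmQuasi…`
in imports of already-ported rows); (ii) `Φ.step ↦ Φ.qstep` with the called Steps lemma replaced by its `…Q`/`_q` twin and the cost `Φ.M` threaded (none in this file unless
listed below); (iii) `Φ.cyl_connected ↦ Φ.cyl_reach` readers (none unless listed); (iv) graph-ball radii / window floors ×`Φ.M` (none unless listed).  Carrier-free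
residents stay imported/exported from the original «SkelFrm1ReachRowsQD» exactly as in the FrmFrom port.  Docstrings and citations are the original's.

-/

noncomputable section

open MeasureTheory ProbabilityTheory
open scoped ENNReal Classical

namespace Summit.CriticalPhenomena.PercolationContinuityZ3.Theorems.Transplant

namespace PlanarSkeletonFrmQuasi

open Literature.Probability.Percolation Literature.Probability.LatticeModels SimpleGraph GadgetSystem ProbeHistory HSiteScheme Contour KNCells
open Literature.Probability.Percolation.KozmaNitzan.Cells (oth sgOf)
open KNCells.KSchA KNLevels ChainPlanar ChainPara
open Literature.Barriers.CriticalPhenomena (HasExponentialGrowth graphBall graphBall_mono mem_graphBall_self)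
open Skel (ReachOblAtHNF excess)
open SkelI (tanOff)
open SkelConc (Consts)
open BoxProdZ2 (ConcRadiiG)
open TwoAxis.Para (modulus)
open Skelφ (oriφ trφ)
open Skelφ.StepI (DataN DataNS OutNS)

namespace NegB

open Neg

section Fst

variable {κ : Consts} {V : Type} [DecidableEq V] [Countable V] {G : SimpleGraph V} [G.LocallyFinite] {Φ : PlanarSkeletonFrmQuasi G} {t : V} {p : unitInterval}
  {hC : Φ.CylSubcritical p} {gv fv : Neg.FSlot} {Pv : PSlot} {Sv : SSlot} {cv : CSlot} {bv : BSlot} {O : OutNS V} {q : unitInterval}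

set_option hygiene false in local notation "g°" => PlanarSkeletonFrmQuasi.NegB.gOf κ Φ t p O gv
set_option hygiene false in local notation "f°" => PlanarSkeletonFrmQuasi.NegB.fOf κ Φ t p O fv
set_option hygiene false in local notation "c°" => PlanarSkeletonFrmQuasi.NegB.cOf κ Φ t p O gv fv cv
set_option hygiene false in local notation "nL°" => PlanarSkeletonFrmQuasi.NegB.nL κ Φ t p O.merged g° f°
set_option hygiene false in local notation "ℓL°" => PlanarSkeletonFrmQuasi.NegB.ℓL κ Φ t p O.merged g° f°
set_option hygiene false in local notation "hL°" => PlanarSkeletonFrmQuasi.NegB.hL κ Φ t p O.merged g° f°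
set_option hygiene false in local notation "vL°" => PlanarSkeletonFrmQuasi.NegB.vL κ Φ t p O.merged g° f°
set_option hygiene false in local notation "vβL°" => PlanarSkeletonFrmQuasi.NegB.vβL κ Φ t p O.merged g° f°
set_option hygiene false in local notation "φL°" => PlanarSkeletonFrmQuasi.NegB.φL κ Φ t p O.D O.DT.toDataN O.ori g° f°
set_option hygiene false in local notation "ψ°" => PlanarSkeletonFrmQuasi.NegB.fineOA κ Φ t p O.D O.DT.toDataN O.ori g° f°
set_option hygiene false in local notation "P°" => PlanarSkeletonFrmQuasi.NegB.fcellsS κ Φ t p O.merged g° f° c°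
set_option hygiene false in local notation "Λ°" => PlanarSkeletonFrmQuasi.NegB.schedOfS κ Φ t p O.merged g° f° c° (Sv κ Φ t p O.merged g° f° q)
set_option hygiene false in local notation "b°" => PlanarSkeletonFrmQuasi.NegB.bOf κ Φ t p O gv fv bv
set_option hygiene false in local notation "F°" => PlanarSkeletonFrmQuasi.NegB.prFA κ Φ t p O.merged g° f°
set_option hygiene false in local notation "S°" => (KSchA.mk (PlanarSkeletonFrmQuasi.NegB.ΓQ κ Φ t p O gv fv Sv cv bv q) q κ.δ : KSchA V ℕ)
set_option hygiene false in local notation "FD°" => PlanarSkeletonFrmQuasi.NegB.FDQ κ Φ t p O gv fv Sv cv q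
set_option hygiene false in local notation "e₀" => (((0 : Fin 2), true) : MDir)

/-- **The oriented fine map of record IS the fine skeleton at the lattice record `prFA`** (by `rfl`). [folklore] -/
theorem fineOA_eq_fineSkel {κ : Consts} {V : Type} [DecidableEq V] [Countable V] {G : SimpleGraph V} [G.LocallyFinite] {Φ : PlanarSkeletonFrmQuasi G} {t : V} {p : unitInterval} {gv : Neg.FSlot} {fv : Neg.FSlot} {O : OutNS V} :
    ψ° = Skelφ.fineSkel φL° t (F°).A nL° hL° vL° vβL° (F°).c₀ (F°).c₁ ((F°).D / 2) ((F°).D / 2) (F°).D := rfl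

-- GEN-Q (R-2, captain 2026-08-27): `PlanarSkeletonFrmFrom.NegB.reachOblAtHNF_frmQ3D_fst` is not in the used cone of the node top — not ported.

/-! ## §2 Second axis -/

set_option hygiene false in local notation "e₁" => (((1 : Fin 2), true) : MDir)

-- GEN-Q (R-2, captain 2026-08-27): `PlanarSkeletonFrmFrom.NegB.reachOblAtHNF_frmQ3D_snd` is not in the used cone of the node top — not ported.

end Fst

end NegB

end PlanarSkeletonFrmQuasi

end Summit.CriticalPhenomena.PercolationContinuityZ3.Theorems.Transplant

end
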